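import Summits.ResolutionOfSingularities.ResolutionOfSingularities.Theorems.WildConesCampaignW46HypersurfacesCharTwoNearLocus
import Mathlib.Algebra.Polynomial.Roots
import Mathlib.Algebra.Polynomial.Degree.SmallDegree
import Mathlib.LinearAlgebra.FiniteDimensional.Lemmas

/-!
# [OURS · L1 W4.6, rung (ii) at p = 2, EVERY dimension n] COUNTING THE INFINITELY-NEAR DOUBLE POINTS:
# in corank `e = 2` a double point of `z² = a(u₁,…,uₙ)` has AT MOST THREE infinitely-near double points,
# unless the tangent cubic vanishes on the kernel plane of the polar form, in which case EVERY point of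
# the kernel line `ℙ¹ ⊂ ℙ^{n−1}` is one — over every field of characteristic 2

HONEST FRAMING. Everything here is OURS: theorems about route WildCones' own TYPED point-blow-up dynamics
(`Theorems/WildConesClassicalRegimesDefs.lean`: states `c`, `step i τ c` = blow up the point, chart `u_i`,
translate by `τ`, delete squares; `MultP` = double point, `Isol`) and the seat's invariants `polarMatrix`
(p502936), `milnorEmbDim` (p498937: `e(c) = dim ker P`) and `degForm` (p522667: the tangent cubic
`a₃(w) = degForm 3 (ser c) w`). NOTHING here is a statement of the manuscript [Hironaka2017]; no FACT-LIST
premise; AI review is weaker than expert review. Cell res-hironaka (LADDER-RESOLUTION rung L, D-0089), slot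
W4.6, seat res-L1-s46-pv-4 (gen 5); host route `WildCones`, crux `ClassicalRegimes`
(stmt-ResolutionOfSingularities-16884; proved).

WHY / WHAT. By the near-point criterion (`hypersurface_multP_step_iff`, gen 5) the infinitely-near double
points of an isolated double state are the points of the projective kernel `ℙ(ker P)` on the tangent
cubic. Gens 3–4 treated `e ≤ 1` (at most one) and decided ISOLATEDNESS of the successors at `e = 2` by
`h₂`; this file COUNTS them at `e = 2`, where `ℙ(ker P)` is a line and the cubic restricts to a binary
cubic:

* `exists_linePoly` — along an affine line `u + x v` the cubic form is a polynomial in `x` of degree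
  `≤ 3` with `x³`-coefficient `a₃(v)` (generic-degree coefficient of a product, `coeff_prod_of_natDegree_le'`).
* `hypersurface_nearPoints_whole_kernel_iff` (any `e`) — EVERY non-zero kernel vector is a near double
  point iff the cubic form vanishes on the kernel.
* `hypersurface_nearPoints_le_three` (`e = 2`) — if the cubic form does NOT vanish identically on the
  kernel plane, there is a set `S` of at most THREE vectors such that every near vector
  `w = (τ with w_i = 1)` of a double successor `(i, τ)` is a multiple of a member of `S`: at most three
  infinitely-near double points. (Kernel basis `v₁, v₂` with `a₃(v₁) ≠ 0`; a near vector is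
  `b (v₂ + x v₁)` with `x` a root of the line polynomial, which is non-zero of degree `≤ 3`.)
* `hypersurface_nearPoints_dichotomy` (`e = 2`) — hence EITHER at most three near double points OR the
  whole kernel line consists of near double points (then, over an infinite field, infinitely many; by
  gen 4, `h₂ = 3` there and all of them are non-isolated — the link `a₃|_K ≡ 0 ⇔ h₂ = 3` is NOT proved
  in this file).

It replaces the role of the FINITENESS / explicit description of the candidate centres after one blow-up
(Th. 16.6 p.84, `D′ = ∇′ ∩ π⁻¹(D)`) for corank-two double points — NOT a statement of the manuscript.

References: E. Casas-Alvero, Singularities of Plane Curves, LMS LN 276 (2000) §3 (tangent cone and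
infinitely near points: context) [CasasAlvero2000]; G.-M. Greuel, G. Pfister, J. Algebra 689 (2026)
[GreuelPfister2026] (context); H. Hironaka, ms. 2017 [Hironaka2017] Th. 16.6 p.84 — role replaced only.
-/

noncomputable section

-- single-problem summit: the doubled namespace component `ResolutionOfSingularities` is forced
set_option linter.dupNamespace false

open scoped BigOperators Classical

open MvPowerSeries IsLocalRing

open Literature.AlgebraicGeometry.Resolution

namespace Summit.ResolutionOfSingularities.ResolutionOfSingularities.Theorems

namespace CampaignW46.HypersurfacesCharTwo

open WildCones WildCones.MuDropCharTwoOrdP ThreefoldsCharTwo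

variable {κ : Type} [Field κ] {n : ℕ}

/-! ## The cubic form along a line is a cubic polynomial -/

/-- [OURS · L1 W4.6] Generic-degree coefficient of a product of polynomials with individually bounded
degrees: `[X^{Σ d_s}] Π p_s = Π [X^{d_s}] p_s` when `deg p_s ≤ d_s`. [folklore] -/
theorem coeff_prod_of_natDegree_le' {ι : Type} (S : Finset ι) (p : ι → Polynomial κ) (d : ι → ℕ)
    (h : ∀ s ∈ S, (p s).natDegree ≤ d s) :
    (∏ s ∈ S, p s).coeff (∑ s ∈ S, d s) = ∏ s ∈ S, (p s).coeff (d s) := by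
  induction S using Finset.induction_on with
  | empty => simp
  | insert b S hbS ih =>
    rw [Finset.prod_insert hbS, Finset.sum_insert hbS, Finset.prod_insert hbS,
      Polynomial.coeff_mul_add_eq_of_natDegree_le (h b (Finset.mem_insert_self b S))
        ((Polynomial.natDegree_prod_le _ _).trans (Finset.sum_le_sum fun s hs =>
          h s (Finset.mem_insert_of_mem hs))),
      ih (fun s hs => h s (Finset.mem_insert_of_mem hs))]

/-- [OURS · L1 W4.6] The linear polynomial `v X + u` has degree `≤ 1` and `X`-coefficient `v`.
[folklore] -/
theorem natDegree_linear_le' (v u : κ) :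
    (Polynomial.C v * Polynomial.X + Polynomial.C u).natDegree ≤ 1 ∧
      (Polynomial.C v * Polynomial.X + Polynomial.C u).coeff 1 = v := by
  refine ⟨Polynomial.natDegree_linear_le, ?_⟩
  simp [Polynomial.coeff_add, Polynomial.coeff_C]

/-- [OURS · L1 W4.6] **The degree-`d` form along an affine line is a polynomial of degree `≤ d` with
top coefficient the form at the direction**: for `f ∈ κ⟦X₁,…,Xₙ⟧` and vectors `v, u` there is
`h ∈ κ[X]` with `deg h ≤ d`, `[X^d] h = degForm d f v` and `h(x) = degForm d f (u + x v)` for all `x`.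
[folklore] -/
theorem exists_linePoly (d : ℕ) (f : MvPowerSeries (Fin n) κ) (v u : Fin n → κ) :
    ∃ h : Polynomial κ, h.natDegree ≤ d ∧ h.coeff d = degForm d f v ∧
      ∀ x : κ, h.eval x = degForm d f (u + x • v) := by
  set h : Polynomial κ := ∑ A ∈ (Finset.univ : Finset (Fin n)).finsuppAntidiag d,
    Polynomial.C (coeff A f) * ∏ s, (Polynomial.C (v s) * Polynomial.X + Polynomial.C (u s)) ^ (A s)
    with hh
  -- degree of each product
  have hdegA : ∀ A : Fin n →₀ ℕ, A.degree = d →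
      (∏ s, (Polynomial.C (v s) * Polynomial.X + Polynomial.C (u s)) ^ (A s)).natDegree ≤ d := by
    intro A hA
    refine (Polynomial.natDegree_prod_le _ _).trans ?_
    rw [← hA, Finsupp.degree_eq_sum]
    refine Finset.sum_le_sum fun s _ => ?_
    refine Polynomial.natDegree_pow_le.trans ?_
    have := (natDegree_linear_le' (v s) (u s)).1
    calc A s * (Polynomial.C (v s) * Polynomial.X + Polynomial.C (u s)).natDegree ≤ A s * 1 :=
          Nat.mul_le_mul_left _ this
      _ = A s := mul_one _
  -- top coefficient of each product
  have hcoeffA : ∀ A : Fin n →₀ ℕ, A.degree = d →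
      (∏ s, (Polynomial.C (v s) * Polynomial.X + Polynomial.C (u s)) ^ (A s)).coeff d =
        ∏ s, v s ^ (A s) := by
    intro A hA
    have h1 := coeff_prod_of_natDegree_le' (Finset.univ : Finset (Fin n))
      (fun s => (Polynomial.C (v s) * Polynomial.X + Polynomial.C (u s)) ^ (A s)) (fun s => A s)
      (fun s _ => Polynomial.natDegree_pow_le.trans (by
        have := (natDegree_linear_le' (v s) (u s)).1
        calc A s * (Polynomial.C (v s) * Polynomial.X + Polynomial.C (u s)).natDegree ≤ A s * 1 :=
              Nat.mul_le_mul_left _ this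
          _ = A s := mul_one _))
    rw [← Finsupp.degree_eq_sum, hA] at h1
    rw [h1]
    refine Finset.prod_congr rfl fun s _ => ?_
    have h2 := Polynomial.coeff_pow_of_natDegree_le (m := A s) (natDegree_linear_le' (v s) (u s)).1
    rw [mul_one] at h2
    rw [h2, (natDegree_linear_le' (v s) (u s)).2]
  refine ⟨h, ?_, ?_, fun x => ?_⟩
  · rw [hh]
    refine (Polynomial.natDegree_sum_le_of_forall_le _ _ fun A hA => ?_)
    refine (Polynomial.natDegree_C_mul_le _ _).trans ?_
    exact hdegA A (mem_finsuppAntidiag_univ_iff_degree'.mp hA)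
  · rw [hh, Polynomial.finsetSum_coeff]
    unfold degForm
    refine Finset.sum_congr rfl fun A hA => ?_
    rw [Polynomial.coeff_C_mul, hcoeffA A (mem_finsuppAntidiag_univ_iff_degree'.mp hA)]
  · rw [hh, Polynomial.eval_finsetSum]
    unfold degForm
    refine Finset.sum_congr rfl fun A _ => ?_
    rw [Polynomial.eval_mul, Polynomial.eval_C, Polynomial.eval_prod]
    congr 1
    refine Finset.prod_congr rfl fun s _ => ?_
    rw [Polynomial.eval_pow]
    congr 1
    simp only [Polynomial.eval_add, Polynomial.eval_mul, Polynomial.eval_C, Polynomial.eval_X,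
      Pi.add_apply, Pi.smul_apply, smul_eq_mul]
    ring

/-- [OURS · L1 W4.6] The degree form (of positive degree) vanishes at the zero vector. [folklore] -/
theorem degForm_zero_vec {d : ℕ} (hd : d ≠ 0) (f : MvPowerSeries (Fin n) κ) :
    degForm d f (0 : Fin n → κ) = 0 := by
  have h := degForm_smul_vec d f (0 : κ) (0 : Fin n → κ)
  rwa [smul_zero, zero_pow hd, zero_mul] at h

/-! ## The whole kernel, or the cubic does not vanish on it -/

/-- [OURS · L1 W4.6 rung (ii) at `p = 2`, every dimension, every corank; NOT a statement of the
manuscript] **THE WHOLE KERNEL CONSISTS OF NEAR DOUBLE POINTS IFF THE TANGENT CUBIC VANISHES ON IT**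
(isolated double state `c`): every non-zero kernel vector `w` (`w·P = 0`), read in the chart of any of
its non-zero coordinates, gives a double successor — iff `a₃` vanishes on `ker P`. In corank `e ≥ 2`
over an infinite field this is the case of INFINITELY MANY infinitely-near double points (a positive-
dimensional double locus on the exceptional divisor). [folklore] -/
theorem hypersurface_nearPoints_whole_kernel_iff [CharP κ 2] (c : (Fin n → ℕ) → κ) (hM : MultP 2 n κ c)
    (hI : Isol 2 n κ c) :
    (∀ (w : Fin n → κ) (i : Fin n), Matrix.vecMul w (polarMatrix (ser 2 n κ c)) = 0 → w i ≠ 0 →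
        MultP 2 n κ (step 2 n κ i ((w i)⁻¹ • w) c)) ↔
      ∀ w : Fin n → κ, Matrix.vecMul w (polarMatrix (ser 2 n κ c)) = 0 → degForm 3 (ser 2 n κ c) w = 0 := by
  constructor
  · intro h w hker
    by_cases hw : w = 0
    · rw [hw]; exact degForm_zero_vec (by norm_num) _
    · obtain ⟨i, hi⟩ : ∃ i, w i ≠ 0 := by
        by_contra h0
        push Not at h0
        exact hw (funext h0)
      have hM' := h w i hker hi
      have hcub := hypersurface_cubic_eq_zero_of_double_successor c i _ hM hM'
      rw [update_inv_smul_eq hi, degForm_smul_vec] at hcub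
      exact (mul_eq_zero.mp hcub).resolve_left (pow_ne_zero 3 (inv_ne_zero hi))
  · intro h w i hker hi
    exact hypersurface_multP_step_of_vec c hM hI hi hker (h w hker)

/-! ## Corank two: at most three near double points -/

/-- [OURS · L1 W4.6] In corank two, a kernel vector `v₁ ≠ 0` can be completed to a SPANNING pair of the
kernel: there is a kernel vector `v₂`, not a multiple of `v₁`, with `ker P = {a v₁ + b v₂}`. [folklore] -/
theorem exists_kernel_pair [CharP κ 2] {c : (Fin n → ℕ) → κ} (hM : MultP 2 n κ c)
    (he : milnorEmbDim 2 n κ c = 2) {v₁ : Fin n → κ} (hv₁ : v₁ ≠ 0)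
    (hker₁ : Matrix.vecMul v₁ (polarMatrix (ser 2 n κ c)) = 0) :
    ∃ v₂ : Fin n → κ, Matrix.vecMul v₂ (polarMatrix (ser 2 n κ c)) = 0 ∧ (∀ r : κ, v₂ ≠ r • v₁) ∧
      ∀ w : Fin n → κ, Matrix.vecMul w (polarMatrix (ser 2 n κ c)) = 0 →
        ∃ a b : κ, a • v₁ + b • v₂ = w := by
  set K := LinearMap.ker (polarMatrix (ser 2 n κ c)).mulVecLin with hK
  have hfr : Module.finrank κ K = 2 := by rw [hK, finrank_ker_polarMatrix hM, he]
  have hv₁K : v₁ ∈ K := (mem_ker_polarMatrix_iff _ _).mpr hker₁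
  -- the line through `v₁` is a proper subspace of the kernel
  have hL : (κ ∙ v₁) < K := by
    refine lt_of_le_of_ne ((Submodule.span_singleton_le_iff_mem v₁ K).mpr hv₁K) (fun hEq => ?_)
    have h1 := finrank_span_singleton (K := κ) hv₁
    rw [hEq, hfr] at h1
    norm_num at h1
  obtain ⟨v₂, hv₂K, hv₂L⟩ := SetLike.exists_of_lt hL
  have hker₂ : Matrix.vecMul v₂ (polarMatrix (ser 2 n κ c)) = 0 := (mem_ker_polarMatrix_iff _ _).mp hv₂K
  have hnot : ∀ r : κ, v₂ ≠ r • v₁ := by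
    intro r hr
    exact hv₂L (Submodule.mem_span_singleton.mpr ⟨r, hr.symm⟩)
  -- the pair spans the kernel
  set M := Submodule.span κ ({v₁, v₂} : Set (Fin n → κ)) with hMdef
  have hMK : M ≤ K := by
    rw [hMdef, Submodule.span_le]
    intro x hx
    rcases hx with rfl | hx
    · exact hv₁K
    · rw [Set.mem_singleton_iff] at hx
      rw [hx]
      exact hv₂K
  have hLM : (κ ∙ v₁) < M := by
    refine lt_of_le_of_ne (Submodule.span_mono (Set.singleton_subset_iff.mpr
      (Set.mem_insert v₁ _))) (fun hEq => ?_)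
    apply hv₂L
    rw [hEq, hMdef]
    exact Submodule.subset_span (Set.mem_insert_of_mem _ (Set.mem_singleton v₂))
  haveI : FiniteDimensional κ K := FiniteDimensional.finiteDimensional_submodule K
  haveI : FiniteDimensional κ M := Submodule.finiteDimensional_of_le hMK
  have hfrM : 2 ≤ Module.finrank κ M := by
    have h1 := Submodule.finrank_lt_finrank_of_lt hLM
    rw [finrank_span_singleton hv₁] at h1
    omega
  have hMeq : M = K := Submodule.eq_of_le_of_finrank_le hMK (by rw [hfr]; exact hfrM)
  refine ⟨v₂, hker₂, hnot, fun w hw => ?_⟩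
  have hwM : w ∈ M := by rw [hMeq]; exact (mem_ker_polarMatrix_iff _ _).mpr hw
  rw [hMdef, Submodule.mem_span_pair] at hwM
  exact hwM

/-- [OURS · L1 W4.6 rung (ii) at `p = 2`, every dimension `n`; NOT a statement of the manuscript] **IN
CORANK TWO THERE ARE AT MOST THREE INFINITELY-NEAR DOUBLE POINTS, unless the tangent cubic vanishes on
the kernel plane.** Let `c` be an isolated double state of `z² = a(u₁,…,uₙ)` (any field of
characteristic `2`) with `e(c) = 2`, and suppose the cubic form `a₃` does not vanish at some kernel
vector. Then there is a finite set `S` of AT MOST THREE vectors such that for every chart `i` and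
translation `τ` with a double successor, the near vector `w = (τ with w_i = 1)` is a multiple of a member
of `S`: the infinitely-near double points are at most three points of the kernel line
`ℙ(ker P) ≅ ℙ¹ ⊂ ℙ^{n−1}`. (With a kernel pair `v₁, v₂`, `a₃(v₁) ≠ 0`: a near vector is `b (v₂ + x v₁)`
with `x` a root of `h(x) = a₃(v₂ + x v₁)`, a NON-ZERO polynomial of degree `≤ 3`, `[x³] h = a₃(v₁)`.)
By gen 4 these successors are then isolated (`h₂ ≤ 2`; the identification is not proved here).
[folklore] -/
theorem hypersurface_nearPoints_le_three [CharP κ 2] (c : (Fin n → ℕ) → κ) (hM : MultP 2 n κ c)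
    (hI : Isol 2 n κ c) (he : milnorEmbDim 2 n κ c = 2)
    (hcub : ∃ v : Fin n → κ, Matrix.vecMul v (polarMatrix (ser 2 n κ c)) = 0 ∧
      degForm 3 (ser 2 n κ c) v ≠ 0) :
    ∃ S : Finset (Fin n → κ), S.card ≤ 3 ∧
      ∀ (i : Fin n) (τ : Fin n → κ), MultP 2 n κ (step 2 n κ i τ c) →
        ∃ w ∈ S, ∃ r : κ, Function.update τ i 1 = r • w := by
  obtain ⟨v₁, hker₁, hcub₁⟩ := hcub
  have hv₁ : v₁ ≠ 0 := by
    intro h0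
    rw [h0, degForm_zero_vec (by norm_num)] at hcub₁
    exact hcub₁ rfl
  obtain ⟨v₂, -, -, hspan⟩ := exists_kernel_pair hM he hv₁ hker₁
  obtain ⟨h, hdeg, hcoeff, heval⟩ := exists_linePoly 3 (ser 2 n κ c) v₁ v₂
  have hne : h ≠ 0 := by
    intro h0
    rw [h0, Polynomial.coeff_zero] at hcoeff
    exact hcub₁ hcoeff.symm
  refine ⟨h.roots.toFinset.image (fun x => v₂ + x • v₁), ?_, fun i τ hM' => ?_⟩
  · refine Finset.card_image_le.trans ((Multiset.toFinset_card_le _).trans ?_)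
    exact (Polynomial.card_roots' h).trans hdeg
  · obtain ⟨hker, hcubw⟩ := (hypersurface_multP_step_iff c i τ hM hI).mp hM'
    obtain ⟨a, b, hab⟩ := hspan _ hker
    -- `b ≠ 0`: otherwise `w = a v₁` with `a ≠ 0` and `a₃(w) = a³ a₃(v₁) ≠ 0`
    have hb : b ≠ 0 := by
      intro hb0
      rw [hb0, zero_smul, add_zero] at hab
      have ha : a ≠ 0 := by
        intro ha0
        have h1 := congrFun hab i
        rw [ha0, zero_smul, Function.update_self] at h1
        exact zero_ne_one h1
      rw [← hab, degForm_smul_vec] at hcubw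
      exact (mul_ne_zero (pow_ne_zero 3 ha) hcub₁) hcubw
    -- `w = b (v₂ + (a/b) v₁)` and `a/b` is a root of `h`
    have hw : Function.update τ i 1 = b • (v₂ + (a / b) • v₁) := by
      rw [← hab, smul_add, smul_smul, mul_div_cancel₀ a hb, add_comm]
    have hroot : (a / b) ∈ h.roots.toFinset := by
      rw [Multiset.mem_toFinset, Polynomial.mem_roots hne, Polynomial.IsRoot.def, heval]
      have h1 := hcubw
      rw [hw, degForm_smul_vec] at h1
      exact (mul_eq_zero.mp h1).resolve_left (pow_ne_zero 3 hb)
    exact ⟨v₂ + (a / b) • v₁, Finset.mem_image.mpr ⟨a / b, hroot, rfl⟩, b, hw⟩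

/-- [OURS · L1 W4.6 rung (ii) at `p = 2`, every dimension `n`; NOT a statement of the manuscript] **THE
CORANK-TWO DICHOTOMY for the infinitely-near double points** of an isolated double state with
`e(c) = 2`: EITHER there are at most three of them (a set `S` of `≤ 3` vectors of which every near
vector is a multiple), OR the tangent cubic vanishes on the kernel plane and EVERY non-zero kernel
vector is a near double point (the whole line `ℙ(ker P)`). [folklore] -/
theorem hypersurface_nearPoints_dichotomy [CharP κ 2] (c : (Fin n → ℕ) → κ) (hM : MultP 2 n κ c)
    (hI : Isol 2 n κ c) (he : milnorEmbDim 2 n κ c = 2) :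
    (∃ S : Finset (Fin n → κ), S.card ≤ 3 ∧
      ∀ (i : Fin n) (τ : Fin n → κ), MultP 2 n κ (step 2 n κ i τ c) →
        ∃ w ∈ S, ∃ r : κ, Function.update τ i 1 = r • w) ∨
    ((∀ w : Fin n → κ, Matrix.vecMul w (polarMatrix (ser 2 n κ c)) = 0 →
        degForm 3 (ser 2 n κ c) w = 0) ∧
      ∀ (w : Fin n → κ) (i : Fin n), Matrix.vecMul w (polarMatrix (ser 2 n κ c)) = 0 → w i ≠ 0 →
        MultP 2 n κ (step 2 n κ i ((w i)⁻¹ • w) c)) := by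
  by_cases h : ∃ v : Fin n → κ, Matrix.vecMul v (polarMatrix (ser 2 n κ c)) = 0 ∧
      degForm 3 (ser 2 n κ c) v ≠ 0
  · exact Or.inl (hypersurface_nearPoints_le_three c hM hI he h)
  · push Not at h
    exact Or.inr ⟨h, (hypersurface_nearPoints_whole_kernel_iff c hM hI).mpr h⟩

/-- [OURS · L1 W4.6 rung (ii) at `p = 2`, every dimension `n`; NOT a statement of the manuscript] **In
corank two, a kernel vector OFF the cubic guarantees finitely many (≤ 3) near double points AND the
existence question reduces to roots**: if moreover some kernel vector `v` has `a₃(v) = 0`, `v ≠ 0`, then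
a double successor exists (at `v`). [folklore] -/
theorem hypersurface_exists_double_successor_of_kernel_root [CharP κ 2] (c : (Fin n → ℕ) → κ)
    (hM : MultP 2 n κ c) (hI : Isol 2 n κ c) {v : Fin n → κ} (hv : v ≠ 0)
    (hker : Matrix.vecMul v (polarMatrix (ser 2 n κ c)) = 0) (hcub : degForm 3 (ser 2 n κ c) v = 0) :
    ∃ (i : Fin n) (τ : Fin n → κ), MultP 2 n κ (step 2 n κ i τ c) := by
  obtain ⟨i, hi⟩ : ∃ i, v i ≠ 0 := by
    by_contra h0
    push Not at h0
    exact hv (funext h0)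
  exact ⟨i, _, hypersurface_multP_step_of_vec c hM hI hi hker hcub⟩

end CampaignW46.HypersurfacesCharTwo

end Summit.ResolutionOfSingularities.ResolutionOfSingularities.Theorems

end
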